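import Literature.NumberTheory.Transcendental.KaehlerHodgeCharmonicRoughMetric
import Literature.NumberTheory.Transcendental.ComplexFormsProofs
import Literature.Geometry.Kaehler.HodgeStarOfVolumeFormProofs
import HarnessLib

/-!
# A rough metric on `ℂ`: `isSmoothForm_dolbeaultBarAdjoint` and `isSmoothForm_dolbeaultAdjoint` fail as stated

This file settles the status of the two named facts
`Literature.NumberTheory.Transcendental.isSmoothForm_dolbeaultBarAdjoint` ("`∂̄*` of a smooth form
is smooth") and `Literature.NumberTheory.Transcendental.isSmoothForm_dolbeaultAdjoint` ("`∂*` of a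
smooth form is smooth") of `Literature/NumberTheory/Transcendental/KaehlerHodge.lean`
(Huybrechts, *Complex Geometry* (2005), Def. 3.1.3: `∂̄* = -* ∘ ∂ ∘ *`, `∂* := -* ∘ ∂̄ ∘ *` on an
hermitian manifold) by an explicit, fully computed counterexample, in the style — and on top of
the rough metric — of `KaehlerHodgeCharmonicRoughMetric.lean` (namespace `RoughMetricC`).

## What is refuted, and why it matters

Both facts sit in a section of `KaehlerHodge.lean` carrying the instances
`[IsManifold 𝓘(ℂ, E) ω M] [IsManifold 𝓘(ℝ, E) ∞ M] [IsContinuousRiemannianBundle E _]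
[IsContMDiffRiemannianBundle 𝓘(ℝ, E) ∞ E _]`, but a `def … : Prop` abstracts only the section
variables its body uses, so as declared they bind only
`[RiemannianBundle fun x ↦ TangentSpace 𝓘(ℝ, E) x]`, Mathlib's fibrewise inner product *of no
regularity at all*, and quantify over such metrics (and over arbitrary charted spaces). In
Huybrechts the metric is a smooth Riemannian metric (Def. 3.1.1, p. 114; Appendix A, p. 281:
`* : 𝒜ᵏ(M) → 𝒜^{m-k}(M)`); for rough metrics both statements are false, so neither
`isSmoothForm_dolbeaultBarAdjoint_holds` nor `isSmoothForm_dolbeaultAdjoint_holds` can ever be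
proved:

* `RoughMetricC.not_isSmoothForm_dolbeaultBarAdjoint`, `RoughMetricC.not_isSmoothForm_dolbeaultAdjoint`:
  the concrete instance (`E = M = ℂ`, `n = 2`, degrees `k = 1`, `m = 0`, i.e. `∂̄*`, `∂*` on
  `2`-forms);
* `not_forall_isSmoothForm_dolbeaultBarAdjoint`, `not_forall_isSmoothForm_dolbeaultAdjoint`: the
  universal closures over Riemannian bundle metrics on `ℂ`-modelled `M` fail.

The positive content under the intended instances is
`Literature.Geometry.Kaehler.IsSmoothForm.dolbeaultBarAdjoint` / `.dolbeaultAdjoint`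
(`KaehlerHodgeAdjointSmoothProofs.lean`), and the corrected, discharged facts are
`isSmoothForm_dolbeaultBarAdjoint_of_isContMDiffRiemannianBundle`
(`KaehlerHodgeBarAdjointSmoothFact.lean`) and
`isSmoothForm_dolbeaultAdjoint_of_isContMDiffRiemannianBundle` (`KaehlerHodgeAdjointSmoothProofs.lean`).

## The counterexample

The metric is the rough metric `g = a dx² + a⁻¹ dy²` of `RoughMetricC` on `M = ℂ`
(`a = fac = exp ∘ switch ∘ re`, positive and differentiable at **no** point; standard orientation;
`RoughMetricC.roughBundle` as a *local* instance of priority `2000` over Mathlib's flat one). Its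
volume form is the constant `dx ∧ dy` (`det g = 1`), so the hypothesis
`ho : IsSmoothForm (riemannianVolumeForm o)` of the facts holds
(`RoughMetricC.isSmoothForm_riemannianVolumeForm`), and on `1`-forms
`⋆(ℓ₀ dx + ℓ₁ dy) = (ℓ₀ / a) dy - a ℓ₁ dx` (`RoughMetricC.hodgeStar_oneForm`); in particular
`⋆dy = -a dx` is differentiable nowhere (`RoughMetricC.not_isSmoothForm_hodgeStar_oneForm_imCLM`).
No exterior derivative of a non-smooth form is ever taken below (so no junk value of `mextDeriv`
enters): we work in degree `k + 1 = 2`, where the first star lands in functions.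

* `twoFormZ = z · (dx ∧ dy) ⊗ 1 := (x • vol) ⊗ 1 + i · ((y • vol) ⊗ 1)` is a smooth complex
  `2`-form (`isSmoothForm_twoFormZ`), and `⋆_ℂ twoFormZ = z` as a complex `0`-form, since
  `⋆(c · vol) = c · ⋆vol = c` pointwise (`hodgeStar_volumeFormL_holds`) and `⋆_ℂ` is the
  `ℂ`-linear extension of `⋆` (`cHodgeStar_twoFormZ`).
* `∂ z = dz`: for a complex `0`-form `∂F = (dF)^{1,0}` (`dolbeault_zeroFormC`, from the definition
  `∂α = ∑_{p+q=k} (d α^{p,q})^{p+1,q}` and `F^{0,0} = F`), `d z = dz` (`mextDeriv_eq_extDeriv`,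
  `extDeriv_constOfIsEmpty`, `fderiv_id`), and `dz` has type `(1,0)` (`isOfType_one_zero_dz`), so
  `(dz)^{1,0} = dz` (`IsOfType.typeComponent_eq_self`): `dolbeault_zeroFormC_id`.
* `dz = dx ⊗ 1 + i · (dy ⊗ 1)`, hence `⋆_ℂ dz = (⋆dx) ⊗ 1 + i · ((⋆dy) ⊗ 1)` and
  `∂̄* twoFormZ = -⋆_ℂ ∂ ⋆_ℂ twoFormZ = -((⋆dx) ⊗ 1 + i · (⋆dy) ⊗ 1)`
  (`cHodgeStar_dolbeault_cHodgeStar_twoFormZ`), whose imaginary part `-⋆dy = a dx` is not smooth.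
  Since real and imaginary parts of smooth complex forms are smooth (`IsSmoothForm.im`),
  `∂̄* twoFormZ` is not smooth although `twoFormZ` and `vol` are: `not_isSmoothForm_dolbeaultBarAdjoint`.
* Symmetrically `twoFormZbar = z̄ · (dx ∧ dy) ⊗ 1`, `⋆_ℂ twoFormZbar = z̄`, `∂̄ z̄ = dz̄`
  (type `(0,1)`, `dolbeaultBar_zeroFormC_conj`), `dz̄ = dx ⊗ 1 - i · (dy ⊗ 1)`, and
  `∂* twoFormZbar = -((⋆dx) ⊗ 1 - i · (⋆dy) ⊗ 1)` has imaginary part `⋆dy = -a dx`: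
  `not_isSmoothForm_dolbeaultAdjoint`.

## Design notes

* Everything metric is inherited from `RoughMetricC` (`KaehlerHodgeCharmonicRoughMetric.lean`):
  the metric, the local bundle instance (re-installed here with the same priority `2000`, together
  with Mathlib's `Complex.finrank_real_complex_fact` as a local instance), `stdOrientation`, the
  volume form, `⋆` on `1`-forms. The new declarations of this file extend that namespace with the
  complex-valued test forms (`zeroFormC`, `oneFormC`, `twoFormZ`, `twoFormZbar`; suffix `C`/`Z` to
  keep clear of the real-valued `zeroForm`, `oneForm` there) and the type computations for `∂`,
  `∂̄` on functions of one complex variable.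
* The four lemmas of §*Generic* (`⋆_ℂ`, `Re`, `Im` of `β ⊗ 1 + i · γ ⊗ 1`) hold on any manifold
  and carry no rough-metric content.
* Degrees are kept in the syntactic shapes produced by unfolding `dolbeaultBarAdjoint` at `k = 1`,
  `m = 0` (`1 + 1 + 0 = 2`, `0 + 1 + 1 = 2`); `hodgeStar_riemannianVolumeForm_two` bridges
  `hodgeStar_volumeFormL_holds` (stated in degree `n`) to degree `1 + 1`.
* No global instance is registered; only data `def`s (test forms) and theorems are added (no
  `Prop`-valued named fact), as in the sibling rough-metric files.

## References

* D. Huybrechts, *Complex Geometry. An Introduction*, Universitext, Springer (2005), §3.1,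
  Def. 3.1.1 (p. 114), Def. 3.1.3; §2.6, Def. 2.6.9 (`∂`, `∂̄`); Appendix A, p. 281.
* F. W. Warner, *Foundations of Differentiable Manifolds and Lie Groups*, GTM 94 (1983), 4.10,
  pp. 149–150 (Riemannian structure = smooth metric; `*` takes smooth forms to smooth forms).
-/

noncomputable section

open scoped Manifold ContDiff Topology ComplexConjugate
open Bundle Module Filter Set
open Literature.Geometry.Kaehler

namespace Literature.NumberTheory.Transcendental

/-! ### Generic: `⋆_ℂ`, real and imaginary parts of `β ⊗ 1 + i · γ ⊗ 1` -/

section Generic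

variable {E : Type*} [NormedAddCommGroup E] [NormedSpace ℂ E]
  {M : Type*} [TopologicalSpace M] [ChartedSpace E M] {k m : ℕ}

/-- `Re (β ⊗ 1 + i · γ ⊗ 1) = β` for real forms `β`, `γ`. [folklore] -/
theorem re_ofReal_add_I_smul_ofReal (β γ : MForm 𝓘(ℝ, E) M ℝ k) :
    (β.ofReal + Complex.I • γ.ofReal).re = β := by
  rw [MForm.re_add, MForm.re_smul, MForm.re_ofReal, MForm.re_ofReal, MForm.im_ofReal]
  simp

/-- `Im (β ⊗ 1 + i · γ ⊗ 1) = γ` for real forms `β`, `γ`. [folklore] -/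
theorem im_ofReal_add_I_smul_ofReal (β γ : MForm 𝓘(ℝ, E) M ℝ k) :
    (β.ofReal + Complex.I • γ.ofReal).im = γ := by
  rw [MForm.im_add, MForm.im_smul, MForm.im_ofReal, MForm.re_ofReal, MForm.im_ofReal]
  simp

variable [FiniteDimensional ℂ E] {n : ℕ} [Fact (finrank ℝ E = n)]
  [RiemannianBundle (fun x : M ↦ TangentSpace 𝓘(ℝ, E) x)]
  (o : (x : M) → Orientation ℝ (TangentSpace 𝓘(ℝ, E) x) (Fin n))

/-- `⋆_ℂ (β ⊗ 1 + i · γ ⊗ 1) = (⋆β) ⊗ 1 + i · (⋆γ) ⊗ 1`: the complex Hodge star is the `ℂ`-linear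
extension of the real one (`MForm.cHodgeStar_ofReal`). Huybrechts (2005), §3.1, p. 115. [folklore] -/
theorem cHodgeStar_ofReal_add_I_smul_ofReal (h : k + m = n) (β γ : MForm 𝓘(ℝ, E) M ℝ k) :
    MForm.cHodgeStar o h (β.ofReal + Complex.I • γ.ofReal) =
      (MForm.hodgeStar o h β).ofReal + Complex.I • (MForm.hodgeStar o h γ).ofReal := by
  rw [map_add, map_smul, MForm.cHodgeStar_ofReal, MForm.cHodgeStar_ofReal]

end Generic

namespace RoughMetricC

attribute [local instance] Complex.finrank_real_complex_fact

local notation "T" => TangentSpace 𝓘(ℝ, ℂ)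

/-! ### Complex `0`- and `1`-forms on `ℂ`; `∂ z = dz`, `∂̄ z̄ = dz̄` (metric-free) -/

/-- The complex `0`-form attached to a complex function on `ℂ`. [folklore] -/
def zeroFormC (f : ℂ → ℂ) : MForm 𝓘(ℝ, ℂ) ℂ ℂ 0 :=
  fun x ↦ ContinuousAlternatingMap.constOfIsEmpty ℝ (T x) (Fin 0) (f x)

/-- The complex `1`-form attached to a family of real-linear maps `ℂ →L[ℝ] ℂ`. [folklore] -/
def oneFormC (ℓ : ℂ → ℂ →L[ℝ] ℂ) : MForm 𝓘(ℝ, ℂ) ℂ ℂ 1 :=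
  fun x ↦ ContinuousAlternatingMap.ofSubsingleton ℝ (T x) ℂ (0 : Fin 1) (ℓ x)

/-- Unfolding of `zeroFormC`. [folklore] -/
@[simp] theorem zeroFormC_apply (f : ℂ → ℂ) (x : ℂ) (v : Fin 0 → T x) :
    zeroFormC f x v = f x := rfl

/-- Unfolding of `oneFormC`. [folklore] -/
@[simp] theorem oneFormC_apply (ℓ : ℂ → ℂ →L[ℝ] ℂ) (x : ℂ) (v : Fin 1 → T x) :
    oneFormC ℓ x v = ℓ x (v 0) := rfl

/-- Every complex `0`-form has type `(0,0)` (there are no vectors to rotate). [folklore] -/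
theorem isOfType_zero_zero (β : MForm 𝓘(ℝ, ℂ) ℂ ℂ 0) : IsOfType 0 0 β := by
  refine ⟨rfl, fun x θ v ↦ ?_⟩
  have hv : (fun i ↦ tangentRotate ℂ x θ (v i)) = v := funext fun i ↦ Fin.elim0 i
  rw [hv]
  simp

/-- `dz` — the identity `ℂ →L[ℝ] ℂ` as a constant complex `1`-form — has type `(1,0)`:
`dz (e^{iθ} v) = e^{iθ} dz (v)`. Huybrechts (2005), §1.3 / §2.6. [folklore] -/
theorem isOfType_one_zero_dz : IsOfType 1 0 (oneFormC fun _ ↦ ContinuousLinearMap.id ℝ ℂ) := by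
  refine ⟨rfl, fun x θ v ↦ ?_⟩
  rw [oneFormC_apply, oneFormC_apply, tangentRotate_apply]
  simp only [ContinuousLinearMap.coe_id', id_eq, Nat.cast_one, Nat.cast_zero, sub_zero,
    Int.cast_one, one_mul, smul_eq_mul]

/-- `dz̄` — complex conjugation `ℂ →L[ℝ] ℂ` as a constant complex `1`-form — has type `(0,1)`:
`dz̄ (e^{iθ} v) = e^{-iθ} dz̄ (v)`. Huybrechts (2005), §1.3 / §2.6. [folklore] -/
theorem isOfType_zero_one_dzbar :
    IsOfType 0 1 (oneFormC fun _ ↦ (Complex.conjCLE : ℂ →L[ℝ] ℂ)) := by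
  refine ⟨rfl, fun x θ v ↦ ?_⟩
  rw [oneFormC_apply, oneFormC_apply, tangentRotate_apply]
  simp only [ContinuousLinearEquiv.coe_coe, Complex.conjCLE_apply, Nat.cast_one, Nat.cast_zero,
    zero_sub, Int.cast_neg, Int.cast_one, smul_eq_mul, map_mul, ← Complex.exp_conj, map_mul,
    Complex.conj_ofReal, Complex.conj_I]
  ring_nf

/-- In the flat complex line, `d` of the complex `0`-form of `f` is the complex `1`-form of
`fderiv ℝ f` (Mathlib's `extDeriv_constOfIsEmpty`, through `mextDeriv_eq_extDeriv`). [folklore] -/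
theorem mextDeriv_zeroFormC (f : ℂ → ℂ) : mextDeriv (zeroFormC f) = oneFormC (fderiv ℝ f) := by
  funext x
  rw [mextDeriv_eq_extDeriv]
  exact extDeriv_constOfIsEmpty f x

/-- **`∂` of a function of one complex variable**: `∂F = (dF)^{1,0}` for the complex `0`-form of
`F` (the definition `∂α = ∑_{p+q=k} (d α^{p,q})^{p+1,q}` in degree `0`, where `F^{0,0} = F`).
Huybrechts (2005), Def. 2.6.9 (`∂ := Π^{p+1,q} ∘ d`). [folklore] -/
theorem dolbeault_zeroFormC (f : ℂ → ℂ) :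
    dolbeault (zeroFormC f) = (oneFormC (fderiv ℝ f)).typeComponent 1 0 := by
  rw [dolbeault, Finset.Nat.antidiagonal_zero, Finset.sum_singleton]
  simp only
  rw [(isOfType_zero_zero (zeroFormC f)).typeComponent_eq_self, mextDeriv_zeroFormC]

/-- **`∂̄` of a function of one complex variable**: `∂̄F = (dF)^{0,1}`. Huybrechts (2005),
Def. 2.6.9 (`∂̄ := Π^{p,q+1} ∘ d`). [folklore] -/
theorem dolbeaultBar_zeroFormC (f : ℂ → ℂ) :
    dolbeaultBar (zeroFormC f) = (oneFormC (fderiv ℝ f)).typeComponent 0 1 := by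
  rw [dolbeaultBar, Finset.Nat.antidiagonal_zero, Finset.sum_singleton]
  simp only
  rw [(isOfType_zero_zero (zeroFormC f)).typeComponent_eq_self, mextDeriv_zeroFormC]

/-- `∂ z = dz` (`d z = dz` is of type `(1,0)`). [folklore] -/
theorem dolbeault_zeroFormC_id :
    dolbeault (zeroFormC fun z ↦ z) = oneFormC fun _ ↦ ContinuousLinearMap.id ℝ ℂ := by
  rw [dolbeault_zeroFormC]
  have hf : fderiv ℝ (fun z : ℂ ↦ z) = fun _ ↦ ContinuousLinearMap.id ℝ ℂ := by
    funext x
    exact fderiv_id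
  rw [hf]
  exact isOfType_one_zero_dz.typeComponent_eq_self

/-- `∂̄ z̄ = dz̄` (`d z̄ = dz̄` is of type `(0,1)`). [folklore] -/
theorem dolbeaultBar_zeroFormC_conj :
    dolbeaultBar (zeroFormC fun z ↦ conj z) =
      oneFormC fun _ ↦ (Complex.conjCLE : ℂ →L[ℝ] ℂ) := by
  rw [dolbeaultBar_zeroFormC]
  have hf : fderiv ℝ (fun z : ℂ ↦ conj z) = fun _ ↦ (Complex.conjCLE : ℂ →L[ℝ] ℂ) := by
    funext x
    exact (Complex.conjCLE : ℂ →L[ℝ] ℂ).fderiv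
  rw [hf]
  exact isOfType_zero_one_dzbar.typeComponent_eq_self

/-- `Re dz = dx` (with the real `1`-forms `oneForm` of `RoughMetricC`). [folklore] -/
theorem re_oneFormC_id :
    (oneFormC fun _ ↦ ContinuousLinearMap.id ℝ ℂ).re = oneForm fun _ ↦ Complex.reCLM := by
  funext x; ext v; rfl

/-- `Im dz = dy`. [folklore] -/
theorem im_oneFormC_id :
    (oneFormC fun _ ↦ ContinuousLinearMap.id ℝ ℂ).im = oneForm fun _ ↦ Complex.imCLM := by
  funext x; ext v; rfl

/-- `Re dz̄ = dx`. [folklore] -/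
theorem re_oneFormC_conj :
    (oneFormC fun _ ↦ (Complex.conjCLE : ℂ →L[ℝ] ℂ)).re = oneForm fun _ ↦ Complex.reCLM := by
  funext x; ext v
  exact Complex.conj_re _

/-- `Im dz̄ = -dy`. [folklore] -/
theorem im_oneFormC_conj :
    (oneFormC fun _ ↦ (Complex.conjCLE : ℂ →L[ℝ] ℂ)).im = -(oneForm fun _ ↦ Complex.imCLM) := by
  funext x; ext v
  exact Complex.conj_im _

/-- `dz = dx ⊗ 1 + i · (dy ⊗ 1)` (`z = x + iy`). [folklore] -/
theorem oneFormC_id_eq :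
    oneFormC (fun _ ↦ ContinuousLinearMap.id ℝ ℂ) =
      (oneForm fun _ ↦ Complex.reCLM).ofReal +
        Complex.I • (oneForm fun _ ↦ Complex.imCLM).ofReal := by
  rw [← re_oneFormC_id, ← im_oneFormC_id, MForm.ofReal_re_add_I_smul_ofReal_im]

/-- `dz̄ = dx ⊗ 1 + i · ((-dy) ⊗ 1)` (`z̄ = x - iy`). [folklore] -/
theorem oneFormC_conj_eq :
    oneFormC (fun _ ↦ (Complex.conjCLE : ℂ →L[ℝ] ℂ)) =
      (oneForm fun _ ↦ Complex.reCLM).ofReal +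
        Complex.I • (-(oneForm fun _ ↦ Complex.imCLM)).ofReal := by
  rw [← re_oneFormC_conj, ← im_oneFormC_conj, MForm.ofReal_re_add_I_smul_ofReal_im]

/-! ### The test `2`-forms `z · (dx ∧ dy)` and `z̄ · (dx ∧ dy)` (rough metric) -/

attribute [local instance 2000] roughBundle

/-- The real `2`-form `x · vol` (`vol = dx ∧ dy`, the volume form of the rough metric). [folklore] -/
def volRe : MForm 𝓘(ℝ, ℂ) ℂ ℝ (1 + 1) := fun x ↦ x.re • riemannianVolumeForm stdOrientation x

/-- The real `2`-form `y · vol`. [folklore] -/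
def volIm : MForm 𝓘(ℝ, ℂ) ℂ ℝ (1 + 1) := fun x ↦ x.im • riemannianVolumeForm stdOrientation x

/-- The complex `2`-form `z · (dx ∧ dy) = (x · vol) ⊗ 1 + i · ((y · vol) ⊗ 1)`. [folklore] -/
def twoFormZ : MForm 𝓘(ℝ, ℂ) ℂ ℂ (1 + 1) := volRe.ofReal + Complex.I • volIm.ofReal

/-- The complex `2`-form `z̄ · (dx ∧ dy) = (x · vol) ⊗ 1 + i · ((-(y · vol)) ⊗ 1)`. [folklore] -/
def twoFormZbar : MForm 𝓘(ℝ, ℂ) ℂ ℂ (1 + 1) := volRe.ofReal + Complex.I • (-volIm).ofReal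

set_option backward.isDefEq.respectTransparency false in
/-- `x · vol` is smooth (the volume form is the constant `dx ∧ dy`). [folklore] -/
theorem isSmoothForm_volRe : IsSmoothForm volRe := by
  refine isSmoothForm_of_contDiff ?_
  have h : flat volRe = fun x : ℂ ↦ x.re • Ω := by
    funext x
    change x.re • riemannianVolumeForm stdOrientation x = _
    rw [riemannianVolumeForm_apply_eq]
  rw [h]
  exact contDiff_re.smul contDiff_const

set_option backward.isDefEq.respectTransparency false in
/-- `y · vol` is smooth. [folklore] -/
theorem isSmoothForm_volIm : IsSmoothForm volIm := by
  refine isSmoothForm_of_contDiff ?_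
  have h : flat volIm = fun x : ℂ ↦ x.im • Ω := by
    funext x
    change x.im • riemannianVolumeForm stdOrientation x = _
    rw [riemannianVolumeForm_apply_eq]
  rw [h]
  exact contDiff_im.smul contDiff_const

/-- `z · (dx ∧ dy)` is a smooth complex `2`-form. [folklore] -/
theorem isSmoothForm_twoFormZ : IsSmoothForm twoFormZ :=
  isSmoothForm_volRe.ofReal.add (isSmoothForm_volIm.ofReal.smul_complex _)

/-- `-(y · vol)` is smooth. [folklore] -/
theorem isSmoothForm_neg_volIm : IsSmoothForm (-volIm) := by
  simpa using isSmoothForm_volIm.smul (-1)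

/-- `z̄ · (dx ∧ dy)` is a smooth complex `2`-form. [folklore] -/
theorem isSmoothForm_twoFormZbar : IsSmoothForm twoFormZbar :=
  isSmoothForm_volRe.ofReal.add (isSmoothForm_neg_volIm.ofReal.smul_complex _)

/-- `⋆vol = 1` for the rough metric, in the degree shape `1 + 1 + 0 = 2` produced by `∂̄*`, `∂*`
on `2`-forms (`hodgeStar_volumeFormL_holds`). [folklore] -/
theorem hodgeStar_riemannianVolumeForm_two (x : ℂ) (h : 1 + 1 + 0 = 2) :
    hodgeStar (stdOrientation x) h (riemannianVolumeForm stdOrientation x) =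
      ContinuousAlternatingMap.constOfIsEmpty ℝ (T x) (Fin 0) 1 :=
  hodgeStar_volumeFormL_holds (stdOrientation x) h

/-- `⋆(c · vol) = c` pointwise, as real `0`-forms. [folklore] -/
theorem hodgeStar_smul_riemannianVolumeForm (h : 1 + 1 + 0 = 2) (c : ℂ → ℝ) :
    MForm.hodgeStar stdOrientation h
        (fun x ↦ c x • riemannianVolumeForm stdOrientation x : MForm 𝓘(ℝ, ℂ) ℂ ℝ (1 + 1)) =
      zeroForm c := by
  funext x
  rw [MForm.hodgeStar_apply, map_smul, hodgeStar_riemannianVolumeForm_two x h]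
  ext v
  simp [zeroForm]

/-- `⋆(x · vol) = x` (real `0`-form). [folklore] -/
theorem hodgeStar_volRe (h : 1 + 1 + 0 = 2) :
    MForm.hodgeStar stdOrientation h volRe = zeroForm fun x ↦ x.re :=
  hodgeStar_smul_riemannianVolumeForm h _

/-- `⋆(y · vol) = y` (real `0`-form). [folklore] -/
theorem hodgeStar_volIm (h : 1 + 1 + 0 = 2) :
    MForm.hodgeStar stdOrientation h volIm = zeroForm fun x ↦ x.im :=
  hodgeStar_smul_riemannianVolumeForm h _

/-- **`⋆_ℂ (z · (dx ∧ dy)) = z`** as a complex `0`-form. [folklore] -/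
theorem cHodgeStar_twoFormZ (h : 1 + 1 + 0 = 2) :
    MForm.cHodgeStar stdOrientation h twoFormZ = zeroFormC fun z ↦ z := by
  rw [twoFormZ, cHodgeStar_ofReal_add_I_smul_ofReal, hodgeStar_volRe, hodgeStar_volIm]
  funext x; ext v
  apply Complex.ext <;> simp [zeroForm]

/-- **`⋆_ℂ (z̄ · (dx ∧ dy)) = z̄`** as a complex `0`-form. [folklore] -/
theorem cHodgeStar_twoFormZbar (h : 1 + 1 + 0 = 2) :
    MForm.cHodgeStar stdOrientation h twoFormZbar = zeroFormC fun z ↦ conj z := by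
  rw [twoFormZbar, cHodgeStar_ofReal_add_I_smul_ofReal, map_neg, hodgeStar_volRe, hodgeStar_volIm]
  funext x; ext v
  apply Complex.ext <;> simp [zeroForm]

/-- **`⋆_ℂ ∂ ⋆_ℂ (z · (dx ∧ dy)) = (⋆dx) ⊗ 1 + i · ((⋆dy) ⊗ 1)`** (so that
`∂̄* (z · dx ∧ dy) = -⋆_ℂ ∂ ⋆_ℂ (z · dx ∧ dy)` has imaginary part `-⋆dy = a dx`). [folklore] -/
theorem cHodgeStar_dolbeault_cHodgeStar_twoFormZ (h : 1 + 1 + 0 = 2) (h' : 0 + 1 + 1 = 2) :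
    MForm.cHodgeStar stdOrientation h' (dolbeault (MForm.cHodgeStar stdOrientation h twoFormZ)) =
      (MForm.hodgeStar stdOrientation h' (oneForm fun _ ↦ Complex.reCLM)).ofReal +
        Complex.I • (MForm.hodgeStar stdOrientation h' (oneForm fun _ ↦ Complex.imCLM)).ofReal := by
  rw [cHodgeStar_twoFormZ, dolbeault_zeroFormC_id, oneFormC_id_eq, cHodgeStar_ofReal_add_I_smul_ofReal]

/-- **`⋆_ℂ ∂̄ ⋆_ℂ (z̄ · (dx ∧ dy)) = (⋆dx) ⊗ 1 + i · ((-⋆dy) ⊗ 1)`** (so that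
`∂* (z̄ · dx ∧ dy)` has imaginary part `⋆dy = -a dx`). [folklore] -/
theorem cHodgeStar_dolbeaultBar_cHodgeStar_twoFormZbar (h : 1 + 1 + 0 = 2) (h' : 0 + 1 + 1 = 2) :
    MForm.cHodgeStar stdOrientation h'
        (dolbeaultBar (MForm.cHodgeStar stdOrientation h twoFormZbar)) =
      (MForm.hodgeStar stdOrientation h' (oneForm fun _ ↦ Complex.reCLM)).ofReal +
        Complex.I • (-MForm.hodgeStar stdOrientation h' (oneForm fun _ ↦ Complex.imCLM)).ofReal := by
  rw [cHodgeStar_twoFormZbar, dolbeaultBar_zeroFormC_conj, oneFormC_conj_eq,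
    cHodgeStar_ofReal_add_I_smul_ofReal, map_neg]

/-! ### Conclusions -/

/-- **The rough metric on `ℂ` violates `isSmoothForm_dolbeaultBarAdjoint`** (`k = 1`, `m = 0`,
`n = 2`): `z · (dx ∧ dy)` and the volume form are smooth, but
`∂̄*(z · dx ∧ dy) = -((⋆dx) ⊗ 1 + i · (⋆dy) ⊗ 1)` is not, since its imaginary part `-⋆dy = a dx` is
differentiable nowhere. [folklore] -/
theorem not_isSmoothForm_dolbeaultBarAdjoint :
    ¬ isSmoothForm_dolbeaultBarAdjoint (k := 1) (m := 0) stdOrientation := by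
  intro H
  have h1 := H isSmoothForm_riemannianVolumeForm (by norm_num : 1 + 1 + 0 = 2) isSmoothForm_twoFormZ
  have h2 : IsSmoothForm (MForm.cHodgeStar stdOrientation (show 0 + 1 + 1 = 2 by norm_num)
      (dolbeault (MForm.cHodgeStar stdOrientation (show 1 + 1 + 0 = 2 by norm_num) twoFormZ))) := by
    have h1' := h1.smul_complex (-1)
    rwa [dolbeaultBarAdjoint, smul_neg, neg_smul, one_smul, neg_neg] at h1'
  rw [cHodgeStar_dolbeault_cHodgeStar_twoFormZ] at h2
  have h3 := h2.im
  rw [im_ofReal_add_I_smul_ofReal] at h3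
  exact not_isSmoothForm_hodgeStar_oneForm_imCLM _ h3

/-- **The rough metric on `ℂ` violates `isSmoothForm_dolbeaultAdjoint`** (`k = 1`, `m = 0`,
`n = 2`): `z̄ · (dx ∧ dy)` and the volume form are smooth, but
`∂*(z̄ · dx ∧ dy) = -((⋆dx) ⊗ 1 - i · (⋆dy) ⊗ 1)` is not, since its imaginary part `⋆dy = -a dx` is
differentiable nowhere. [folklore] -/
theorem not_isSmoothForm_dolbeaultAdjoint :
    ¬ isSmoothForm_dolbeaultAdjoint (k := 1) (m := 0) stdOrientation := by
  intro H
  have h1 := H isSmoothForm_riemannianVolumeForm (by norm_num : 1 + 1 + 0 = 2)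
    isSmoothForm_twoFormZbar
  have h2 : IsSmoothForm (MForm.cHodgeStar stdOrientation (show 0 + 1 + 1 = 2 by norm_num)
      (dolbeaultBar (MForm.cHodgeStar stdOrientation (show 1 + 1 + 0 = 2 by norm_num)
        twoFormZbar))) := by
    have h1' := h1.smul_complex (-1)
    rwa [dolbeaultAdjoint, smul_neg, neg_smul, one_smul, neg_neg] at h1'
  rw [cHodgeStar_dolbeaultBar_cHodgeStar_twoFormZbar] at h2
  have h3 := (h2.im).smul (-1)
  rw [im_ofReal_add_I_smul_ofReal, smul_neg, neg_smul, one_smul, neg_neg] at h3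
  exact not_isSmoothForm_hodgeStar_oneForm_imCLM _ h3

end RoughMetricC

attribute [local instance] Complex.finrank_real_complex_fact
attribute [local instance 2000] RoughMetricC.roughBundle

/-- **`isSmoothForm_dolbeaultBarAdjoint` cannot be discharged as stated**: its universal closure
over Riemannian bundle metrics of no regularity is false (witness: `RoughMetricC.roughBundle` on
`ℂ` with the standard orientation, `RoughMetricC.not_isSmoothForm_dolbeaultBarAdjoint`). Its
content under the intended instances is the theorem
`Literature.Geometry.Kaehler.IsSmoothForm.dolbeaultBarAdjoint`, and the corrected, discharged fact
is `isSmoothForm_dolbeaultBarAdjoint_of_isContMDiffRiemannianBundle`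
(`KaehlerHodgeBarAdjointSmoothFact.lean`). [folklore] -/
theorem not_forall_isSmoothForm_dolbeaultBarAdjoint :
    ¬ ∀ (M : Type) [TopologicalSpace M] [ChartedSpace ℂ M]
        [RiemannianBundle (fun x : M ↦ TangentSpace 𝓘(ℝ, ℂ) x)]
        (o : (x : M) → Orientation ℝ (TangentSpace 𝓘(ℝ, ℂ) x) (Fin 2)),
        isSmoothForm_dolbeaultBarAdjoint (k := 1) (m := 0) o :=
  fun H ↦ RoughMetricC.not_isSmoothForm_dolbeaultBarAdjoint (H ℂ RoughMetricC.stdOrientation)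

/-- **`isSmoothForm_dolbeaultAdjoint` cannot be discharged as stated** either:
`RoughMetricC.not_isSmoothForm_dolbeaultAdjoint`. Its content under the intended instances is the
theorem `Literature.Geometry.Kaehler.IsSmoothForm.dolbeaultAdjoint`, and the corrected, discharged
fact is `isSmoothForm_dolbeaultAdjoint_of_isContMDiffRiemannianBundle`
(`KaehlerHodgeAdjointSmoothProofs.lean`). [folklore] -/
theorem not_forall_isSmoothForm_dolbeaultAdjoint :
    ¬ ∀ (M : Type) [TopologicalSpace M] [ChartedSpace ℂ M]
        [RiemannianBundle (fun x : M ↦ TangentSpace 𝓘(ℝ, ℂ) x)]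
        (o : (x : M) → Orientation ℝ (TangentSpace 𝓘(ℝ, ℂ) x) (Fin 2)),
        isSmoothForm_dolbeaultAdjoint (k := 1) (m := 0) o :=
  fun H ↦ RoughMetricC.not_isSmoothForm_dolbeaultAdjoint (H ℂ RoughMetricC.stdOrientation)

end Literature.NumberTheory.Transcendental
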